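import Summits.MatrixMultiplication.MatrixMultiplication.Theorems.LevelOneGL2Designs.Negative.LevelSpace
import Summits.MatrixMultiplication.MatrixMultiplication.Theorems.LevelTwoBeatsCubes.Negative.GradedNeumannCount

/-!
# Negative lemmas for the crux `LieRankDesigns` (stmt-MatrixMultiplication-7614), part B: walls and the graded Neumann count

Refuter-side (cdisprove) support; no theorem asserts a Theses statement positively.  The bi-invariance
of the level tables (`transl`, `fourierFn_transl`), the interpolation bound, `wall_XZ` and the
submodule `levelSubmodule = F_k|_G` are taken from `LevelOneGL2Designs.Negative.LevelSpace/Exponent`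
(general `m`, `k`; first written in this seat's work file `Cruxes/LieRankDesigns/Disproof.lean`).
New here, for every `GL_m(𝔽_p)` and level `k`:

* `levelSet_transl` — the set-level `levelSet p m k` is closed under `g ↦ f(b g a)`;
* `wall_XY`, `wall_YZ` (`Z ≠ ∅`, resp. `X ≠ ∅`): `|X||Y|, |Y||Z| ≤ N_k := #{M : rk M ≤ k}` via the
  right/left translates of the separators; `volume_sq_le`: `V² ≤ N_k³` (all three walls);
* `neumann_X`, `neumann_Z` — the sibling seat's GRADED NEUMANN COUNT
  (`LevelTwoBeatsCubes.Negative.GradedNeumannCount`, which refuted the `S_n` level-2 crux) transported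
  to `J = F_k|_G`: `|X||Z| + |X|(|Y|−1) ≤ N_k`, `|X||Z| + (|Y|−1)|Z| ≤ N_k`;
* `volume_le_cubicBudget` — hence `|X||Y||Z| ≤ B` for every `B` past the cubic threshold
  (`≈ 0.385·N_k^{3/2}`); e.g. level 1 in `GL_2(𝔽_p)`, `p ≤ 7`: the exponent-3 milestone is dead.
-/

noncomputable section

open scoped BigOperators
open Literature.RepresentationTheory.FiniteGroups

namespace Summit.MatrixMultiplication.MatrixMultiplication.Theorems.LieRankDesigns.Negative

open Summit.MatrixMultiplication.MatrixMultiplication.Theses.LevelGradedCohnUmans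
open Summit.MatrixMultiplication.MatrixMultiplication.Theorems.LevelOneGL2Designs.Negative
  (transl fourierFn_transl rankSupp_transl card_le_card_rankLE_of_deltas wall_XZ levelSubmodule
    levelSubmodule_right_inv levelSubmodule_left_inv sep_clause_of_rankSep finrank_levelSubmodule_le)

variable {p m : ℕ}

section Walls

variable [Fact p.Prime]

/-- The level set of functions is closed under two-sided translation. -/
theorem levelSet_transl {k : ℕ} {f : GLm p m → ℂ} (hf : f ∈ levelSet p m k) (a b : GLm p m) :
    (fun g => f (b * g * a)) ∈ levelSet p m k := by
  obtain ⟨c, hc, hfc⟩ := hf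
  exact ⟨transl a b c, rankSupp_transl a b hc, fun g => by simp only [hfc, fourierFn_transl]⟩

variable {k : ℕ} {X Y Z : Finset (GLm p m)}

/-- **Wall XY**: an `F_k`-separated triple with `Z ≠ ∅` has `|X|·|Y| ≤ N_k`. -/
theorem wall_XY (hsep : RankSep k X Y Z) (hZ : Z.Nonempty) :
    X.card * Y.card ≤ Fintype.card ({M : Mat p m // M.rank ≤ k}) := by
  classical
  obtain ⟨z₀, hz₀⟩ := hZ
  have h := card_le_card_rankLE_of_deltas (k := k) (T := ↥(X ×ˢ Y))
    (fun t => t.1.1⁻¹ * t.1.2) ?_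
  · rwa [Fintype.card_coe, Finset.card_product] at h
  rintro ⟨⟨x₀, y₁⟩, ht⟩
  rw [Finset.mem_product] at ht
  obtain ⟨c, hc, hsepc⟩ := hsep x₀ ht.1 z₀ hz₀
  refine ⟨transl (y₁⁻¹ * z₀) 1 c, rankSupp_transl _ _ hc, ?_⟩
  rintro ⟨⟨x, y⟩, ht'⟩
  rw [Finset.mem_product] at ht'
  rw [fourierFn_transl, one_mul, show x⁻¹ * y * (y₁⁻¹ * z₀) = x⁻¹ * y * y₁⁻¹ * z₀ by group,
    hsepc x ht'.1 y ht'.2 y₁ ht.2 z₀ hz₀]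
  congr 1
  simp only [and_true, Subtype.mk.injEq, Prod.mk.injEq]

/-- **Wall YZ**: an `F_k`-separated triple with `X ≠ ∅` has `|Y|·|Z| ≤ N_k`. -/
theorem wall_YZ (hsep : RankSep k X Y Z) (hX : X.Nonempty) :
    Y.card * Z.card ≤ Fintype.card ({M : Mat p m // M.rank ≤ k}) := by
  classical
  obtain ⟨x₀, hx₀⟩ := hX
  have h := card_le_card_rankLE_of_deltas (k := k) (T := ↥(Y ×ˢ Z))
    (fun t => t.1.1⁻¹ * t.1.2) ?_
  · rwa [Fintype.card_coe, Finset.card_product] at h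
  rintro ⟨⟨y₁, z₀⟩, ht⟩
  rw [Finset.mem_product] at ht
  obtain ⟨c, hc, hsepc⟩ := hsep x₀ hx₀ z₀ ht.2
  refine ⟨transl 1 (x₀⁻¹ * y₁) c, rankSupp_transl _ _ hc, ?_⟩
  rintro ⟨⟨y', z⟩, ht'⟩
  rw [Finset.mem_product] at ht'
  rw [fourierFn_transl, mul_one, show x₀⁻¹ * y₁ * (y'⁻¹ * z) = x₀⁻¹ * y₁ * y'⁻¹ * z by group,
    hsepc x₀ hx₀ y₁ ht.1 y' ht'.1 z ht'.2]
  congr 1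
  simp only [true_and, Subtype.mk.injEq, Prod.mk.injEq, eq_iff_iff]
  constructor
  · rintro ⟨h1, h2⟩; exact ⟨h1.symm, h2⟩
  · rintro ⟨h1, h2⟩; exact ⟨h1.symm, h2⟩

/-- **The three walls at once**: `V² ≤ N_k³`, i.e. `|X||Y||Z| ≤ N_k^{3/2}` for every `F_k`-separated
triple (all three sets nonempty; otherwise `V = 0`). -/
theorem volume_sq_le (hsep : RankSep k X Y Z) :
    (X.card * Y.card * Z.card) ^ 2 ≤ Fintype.card ({M : Mat p m // M.rank ≤ k}) ^ 3 := by
  by_cases hX : X.Nonempty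
  · by_cases hY : Y.Nonempty
    · by_cases hZ : Z.Nonempty
      · have h1 := wall_XY hsep hZ
        have h2 := wall_XZ hsep hY
        have h3 := wall_YZ hsep hX
        calc (X.card * Y.card * Z.card) ^ 2
            = (X.card * Y.card) * (X.card * Z.card) * (Y.card * Z.card) := by ring
          _ ≤ Fintype.card ({M : Mat p m // M.rank ≤ k}) * Fintype.card ({M : Mat p m // M.rank ≤ k}) * Fintype.card ({M : Mat p m // M.rank ≤ k}) := by
            gcongr
          _ = Fintype.card ({M : Mat p m // M.rank ≤ k}) ^ 3 := by ring
      · rw [Finset.not_nonempty_iff_eq_empty.mp hZ]; simp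
    · rw [Finset.not_nonempty_iff_eq_empty.mp hY]; simp
  · rw [Finset.not_nonempty_iff_eq_empty.mp hX]; simp


end Walls

/-! ## The graded Neumann count for `J = F_k|_G` -/

section Neumann

variable [Fact p.Prime] {k : ℕ} {X Y Z : Finset (GLm p m)}

/-- **Graded Neumann count for the crux, `X`-slab**: `|X||Z| + |X|(|Y| − 1) ≤ N_k`. -/
theorem neumann_X (hsep : RankSep k X Y Z) {y₁ z₁ : GLm p m} (hy₁ : y₁ ∈ Y) (hz₁ : z₁ ∈ Z) :
    X.card * Z.card + X.card * (Y.card - 1) ≤ Fintype.card ({M : Mat p m // M.rank ≤ k}) :=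
  (Summit.MatrixMultiplication.MatrixMultiplication.Theorems.LevelTwoBeatsCubes.Negative.packing_X (levelSubmodule p m k) levelSubmodule_right_inv X Y Z
    (sep_clause_of_rankSep hsep) hy₁ hz₁).trans finrank_levelSubmodule_le

/-- **Graded Neumann count for the crux, `Z`-slab**: `|X||Z| + (|Y| − 1)|Z| ≤ N_k`. -/
theorem neumann_Z (hsep : RankSep k X Y Z) {x₁ y₁ : GLm p m} (hx₁ : x₁ ∈ X) (hy₁ : y₁ ∈ Y) :
    X.card * Z.card + (Y.card - 1) * Z.card ≤ Fintype.card ({M : Mat p m // M.rank ≤ k}) :=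
  (Summit.MatrixMultiplication.MatrixMultiplication.Theorems.LevelTwoBeatsCubes.Negative.packing_Z (levelSubmodule p m k) levelSubmodule_left_inv X Y Z
    (sep_clause_of_rankSep hsep) hx₁ hy₁).trans finrank_levelSubmodule_le

/-- **Cubic volume budget for the crux**: any `B` with `4N_k + 1 ≤ 8B` and
`4(4N_k+1)³ ≤ 27(8B − 4N_k − 1)²` (the least such is `≈ 0.385·N_k^{3/2}`) bounds the volume of
every `F_k`-separated triple: `|X||Y||Z| ≤ B`.  (Compare the crux's demand
`|X||Y||Z| > B_k(2+ε)^{3/(2+ε)}`: the surviving window is `(B_k(2+ε)^{3/(2+ε)}, 0.385 N_k^{3/2}]`,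
non-empty for large `p` at every level because `R_k` contains `≈ p^k` near-maximal irreducibles —
unlike the `S_n` level-2 case, where this count refuted `LevelTwoBeatsCubes`.) -/
theorem volume_le_cubicBudget (hsep : RankSep k X Y Z) (B : ℕ)
    (h1 : (4 * (Fintype.card ({M : Mat p m // M.rank ≤ k}) : ℝ) + 1) ≤ 8 * B)
    (h2 : 4 * (4 * (Fintype.card ({M : Mat p m // M.rank ≤ k}) : ℝ) + 1) ^ 3 ≤
      27 * (8 * (B : ℝ) - 4 * Fintype.card ({M : Mat p m // M.rank ≤ k}) - 1) ^ 2) :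
    X.card * Y.card * Z.card ≤ B := by
  obtain hX | ⟨x₁, hx₁⟩ := X.eq_empty_or_nonempty
  · simp [hX]
  obtain hY | ⟨y₁, hy₁⟩ := Y.eq_empty_or_nonempty
  · simp [hY]
  obtain hZ | ⟨z₁, hz₁⟩ := Z.eq_empty_or_nonempty
  · simp [hZ]
  exact Summit.MatrixMultiplication.MatrixMultiplication.Theorems.LevelTwoBeatsCubes.Negative.vol_le _ _ _ _ B (Finset.card_pos.mpr ⟨y₁, hy₁⟩)
    (neumann_X hsep hy₁ hz₁) (neumann_Z hsep hx₁ hy₁)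
    (Summit.MatrixMultiplication.MatrixMultiplication.Theorems.LevelTwoBeatsCubes.Negative.cubic_le_nat _ B h1 h2)


end Neumann

end Summit.MatrixMultiplication.MatrixMultiplication.Theorems.LieRankDesigns.Negative

end
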